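import Literature.NumberTheory.Sieve.FriedlanderIwaniecPrimesLogSineMollifier
import Literature.NumberTheory.Sieve.FriedlanderIwaniecPrimesQuarticForm
import HarnessLib

/-!
# Friedlander–Iwaniec, *The polynomial `X² + Y⁴` captures its primes*, §15 (15.2)–(15.5) and §16 (16.4)–(16.10):
# separation of the variables `z₁`, `z₂` in `log 2|z₁z₂/Δ|` by the Fourier series of the mollified logarithm

Source: J. Friedlander, H. Iwaniec, Ann. of Math. (2) 148 (1998), 945–1040 [FriedlanderIwaniecAnnals1998]
(= arXiv:math/9811185), §15 p. 58 and §16 pp. 58–59.  In both the estimation of `V(β)` (§15) and of `U(β)`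
(§16) the only coupling of `z₁` and `z₂` in the main term `T(β)` ((10.13)) that is not multiplicative is the
logarithm `log 2|z₁z₂/Δ(z₁,z₂)|`, `Δ(z₁,z₂) = Im z̄₁z₂`; by (7.2) `Δ = |z₁z₂| sin(α₂ - α₁)` (`α_j = arg z_j`), so
(15.4) `log 2|z₁z₂/Δ| = -log ½|sin(α₂ - α₁)|`, and the separation is achieved by the Fourier series of the
mollified function `u(α) = -h(α) log ½|sin α|` ((15.5), (16.7)):

> §15, p. 58: "Inserting the Fourier series (15.5) in (15.2) we achieve the separation of variables at the
> cost of `O((log N)²)` [by (15.7) `Σ_ℓ |c_ℓ| ≪ (log N)²`]. After the separation of variables we get by (15.2)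
> `V(β) ≪ (log N)⁴ Σ_{X<ed<Y} Σ_{a (mod d)} |Σ_{ar ≡ s (4d)} ξ_{ers} β_{er+is} (r/d)|² + P⁻¹N²` where …
> `ξ_{ers}` are complex numbers with `|ξ_{ers}| = 1` (these are character values coming out of the separation
> process)."
> §16, p. 59: "Next we expand `u(α)` into its Fourier series `u(α) = Σ_k û(k) e^{ikα}` which converges quite
> rapidly … Hence we can truncate the Fourier series with a small error term, namely (16.9)
> `u(α) = Σ_{|k| ≤ K} û(k) e^{ikα} + O(K⁻¹H² log H)`. Inserting this in (16.4) we get (16.10)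
> `U_d(β) = Σ_{|k| ≤ K} û(k) Σ_{ω (mod 4d)} (ω/d) ΣΣ_{z₁ ≡ ω z₂ (mod 4d)} β_{z₁} β̄_{z₂} (z₁z̄₂/|z₁z₂|)^k
> + O(d⁻¹(P⁻¹ + H⁻¹ + K⁻¹H²)N²)`."

This file PROVES the mechanism of both insertions, for the smooth mollifier `u_H = logSineMollifier H` of
`…LogSineMollifier` (whose Fourier data is `exists_fourier_logSineMollifier`) and for an arbitrary finite sum
`Σ_i w_i u(a_i)` (in the source `i = (z₁, z₂)`, `w_i = f(|Δ|/d) β_{z₁} β̄_{z₂} (ω/d)` resp. the §15 weights, and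
`a_i = arg z₁ - arg z₂`):

* the pointwise identities: `log_two_mul_norm_div_abs_im` ((15.4)/(16.7):
  `log(2|z₁||z₂|/|Δ|) = log 2 - log|sin(arg z₂ - arg z₁)|`), `logSineMollifier_arg_sub_eq` (the mollified
  logarithm EQUALS `log 2|z₁z₂/Δ|` as soon as `|z₁z₂| ≤ H|Δ|`, i.e. off the diagonal `|sin(α₂ - α₁)| ≥ 1/H`),
  and the harmonics `exp_int_mul_arg_mul_I` (`e^{ik arg z} = (z/|z|)^k`), `exp_int_mul_arg_sub_mul_I`
  (`e^{ik(α₁ - α₂)} = (z₁z̄₂/|z₁z₂|)^k`, the shape in (16.10)–(16.11));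
* the separation in a finite sum, for ANY real `u` with Fourier data `c`: `hasSum_sum_mul_fourier`
  (`Σ_i w_i u(a_i) = Σ_k c(k) Σ_i w_i e^{ik a_i}`), `norm_sum_mul_le_tsum_mul` (the §15 use:
  `|Σ_i w_i u(a_i)| ≤ (Σ_k |c(k)|) · sup_k |Σ_i w_i e^{ik a_i}|`), `norm_sum_mul_sub_trunc_le` (the §16 use: a
  pointwise truncation error `E` costs `E Σ_i |w_i|` in the sum);
* the two uses for `u_H` with the constants of `exists_fourier_logSineMollifier`:
  **`exists_logSineMollifier_separation`** — one coefficient sequence `û_H` per `H ≥ 2` such that for every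
  finite sum `|Σ_i w_i u_H(a_i)| ≤ C log²(4H) · sup_k |Σ_i w_i e^{ika_i}|` and
  `|Σ_i w_i u_H(a_i) - Σ_{|k| ≤ K} û_H(k) Σ_i w_i e^{ika_i}| ≤ C·H·log(4H)·K⁻¹ Σ_i |w_i|` (`K ≥ 1`).

The "trivial estimations" of (16.6) (removing `(z₁,z₂) = 1` and the terms near the diagonal) and the
bilinear bounds that follow ((15.8) via Proposition 14.1, (16.11) ff.) are not part of this file.  No named
facts, no `sorry`.

## References
* J. Friedlander, H. Iwaniec, Ann. of Math. (2) 148 (1998), 945–1040, §7 (7.2), §15 (15.2)–(15.7), §16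
  (16.4)–(16.10). [FriedlanderIwaniecAnnals1998]

## Tree / Mathlib
Tree: `conj_mul_im`, `conj_mul_eq_norm_mul_exp` ((7.2), `…QuarticForm`), `logSineMollifier_eq_of_le`,
`exists_fourier_logSineMollifier` (`…LogSineMollifier`); cf. `angularChar_eq_exp` (`…SpinTheorem2`, the same
harmonic for Gaussian integers). Mathlib: `hasSum_sum`, `HasSum.norm_le_of_bounded`, `tsum_mul_right`,
`Complex.exp_int_mul`, `Complex.norm_mul_exp_arg_mul_I`.
-/

noncomputable section

open Real Complex Finset
open scoped ComplexConjugate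

universe u

namespace Literature.NumberTheory.Sieve.FriedlanderIwaniecPrimes

/-! ### (15.4)/(16.7): the logarithm as a function of the angle difference -/

section Angle

/-- `L(-α) = L(α)` for `L = log 2 - log|sin|`. [cite: FriedlanderIwaniecAnnals1998, §15 before (15.6) ("`h(α)` is even")] -/
theorem fiLogSin_neg (α : ℝ) : fiLogSin (-α) = fiLogSin α := by
  unfold fiLogSin; rw [Real.sin_neg, Real.log_neg_eq_log]

/-- `u_H` is even. [cite: FriedlanderIwaniecAnnals1998, §15 before (15.6) ("`h(α)` is even")] -/
theorem logSineMollifier_neg (H α : ℝ) : logSineMollifier H (-α) = logSineMollifier H α := by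
  unfold logSineMollifier logSineCutoff; rw [fiLogSin_neg, Real.sin_neg, neg_sq]

/-- **(15.4)/(16.7)**: `log 2|z₁z₂/Δ| = log 2 - log|sin(α₂ - α₁)|` with `Δ = Im z̄₁z₂ ≠ 0`, `α_j = arg z_j`
(by (7.2) `Δ = |z₁z₂| sin(α₂ - α₁)`). [cite: FriedlanderIwaniecAnnals1998, (15.4) and (16.7) with (7.2)] -/
theorem log_two_mul_norm_div_abs_im {z₁ z₂ : ℂ} (hΔ : (conj z₁ * z₂).im ≠ 0) :
    Real.log (2 * (‖z₁‖ * ‖z₂‖) / |(conj z₁ * z₂).im|) = fiLogSin (arg z₂ - arg z₁) := by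
  rw [conj_mul_im] at hΔ ⊢
  set r := ‖z₁‖ * ‖z₂‖ with hr
  have hr0 : 0 ≤ r := by positivity
  have hrne : r ≠ 0 := by intro h; rw [h, zero_mul] at hΔ; exact hΔ rfl
  have hs : Real.sin (arg z₂ - arg z₁) ≠ 0 := by intro h; rw [h, mul_zero] at hΔ; exact hΔ rfl
  rw [abs_mul, abs_of_nonneg hr0]
  have e : 2 * r / (r * |Real.sin (arg z₂ - arg z₁)|) = 2 / |Real.sin (arg z₂ - arg z₁)| := by
    field_simp
  rw [e, Real.log_div two_ne_zero (abs_ne_zero.mpr hs), Real.log_abs]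
  unfold fiLogSin; rfl

/-- **Off the diagonal the mollifier is invisible**: if `|z₁z₂| ≤ H |Δ(z₁,z₂)|` (i.e. `|sin(α₂ - α₁)| ≥ 1/H`)
then `u_H(α₂ - α₁) = log 2|z₁z₂/Δ|` (`H > 0`).
[cite: FriedlanderIwaniecAnnals1998, §15 after (15.7) and §16 (16.6)–(16.7) (terms with `|α₂ - α₁| ≥ 2πH⁻¹` unchanged)] -/
theorem logSineMollifier_arg_sub_eq {H : ℝ} (hH : 0 < H) {z₁ z₂ : ℂ} (hΔ : (conj z₁ * z₂).im ≠ 0)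
    (hfar : ‖z₁‖ * ‖z₂‖ ≤ H * |(conj z₁ * z₂).im|) :
    logSineMollifier H (arg z₂ - arg z₁) = Real.log (2 * (‖z₁‖ * ‖z₂‖) / |(conj z₁ * z₂).im|) := by
  rw [log_two_mul_norm_div_abs_im hΔ]
  apply logSineMollifier_eq_of_le hH
  rw [conj_mul_im] at hΔ hfar
  set r := ‖z₁‖ * ‖z₂‖ with hr
  have hr0 : 0 ≤ r := by positivity
  have hrne : r ≠ 0 := by intro h; rw [h, zero_mul] at hΔ; exact hΔ rfl
  have hrpos : 0 < r := lt_of_le_of_ne hr0 (Ne.symm hrne)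
  rw [abs_mul, abs_of_nonneg hr0] at hfar
  rw [div_le_iff₀ hH]
  have h1 : r * 1 ≤ r * (|Real.sin (arg z₂ - arg z₁)| * H) := by nlinarith
  exact le_of_mul_le_mul_left h1 hrpos

/-- **The harmonics**: `e^{ik arg z} = (z/|z|)^k` (`z ≠ 0`, `k ∈ ℤ`).
[cite: FriedlanderIwaniecAnnals1998, (16.10)–(16.11) (the factor `(z₁z̄₂/|z₁z₂|)^k`)] -/
theorem exp_int_mul_arg_mul_I {z : ℂ} (hz : z ≠ 0) (k : ℤ) :
    Complex.exp (k * arg z * I) = (z / (‖z‖ : ℂ)) ^ k := by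
  have hR : (‖z‖ : ℂ) ≠ 0 := by exact_mod_cast (norm_pos_iff.mpr hz).ne'
  have he : z / (‖z‖ : ℂ) = Complex.exp (arg z * I) := by
    rw [div_eq_iff hR, mul_comm]; exact (Complex.norm_mul_exp_arg_mul_I z).symm
  rw [he, ← Complex.exp_int_mul]; ring_nf

/-- **The harmonics separate**: `e^{ik(α₁ - α₂)} = (z₁z̄₂/(|z₁||z₂|))^k` (`z₁, z₂ ≠ 0`), the shape in which
the separated sum appears in (16.10)–(16.11). [cite: FriedlanderIwaniecAnnals1998, (16.10)–(16.11)] -/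
theorem exp_int_mul_arg_sub_mul_I {z₁ z₂ : ℂ} (hz₁ : z₁ ≠ 0) (hz₂ : z₂ ≠ 0) (k : ℤ) :
    Complex.exp (k * ((arg z₁ - arg z₂ : ℝ) : ℂ) * I) =
      (z₁ * conj z₂ / ((‖z₁‖ * ‖z₂‖ : ℝ) : ℂ)) ^ k := by
  have h := conj_mul_eq_norm_mul_exp z₂ z₁
  have hR : ((‖z₁‖ * ‖z₂‖ : ℝ) : ℂ) ≠ 0 := by
    exact_mod_cast (mul_pos (norm_pos_iff.mpr hz₁) (norm_pos_iff.mpr hz₂)).ne'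
  have he : z₁ * conj z₂ / ((‖z₁‖ * ‖z₂‖ : ℝ) : ℂ) = Complex.exp (((arg z₁ - arg z₂ : ℝ) : ℂ) * I) := by
    rw [div_eq_iff hR, mul_comm z₁, h, mul_comm ‖z₂‖ ‖z₁‖]
    exact mul_comm _ _
  rw [he, ← Complex.exp_int_mul]; ring_nf

end Angle

/-! ### Separation of variables in a finite sum -/

section Separation

variable {ι : Type*}

/-- Interchanging the finite sums: `Σ_k c(k) Σ_i w_i e^{ika_i} = Σ_i w_i Σ_k c(k) e^{ika_i}`. [folklore] -/
private theorem lss_sum_comm (s : Finset ι) (w : ι → ℂ) (a : ι → ℝ) (c : ℤ → ℂ) (T : Finset ℤ) :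
    ∑ k ∈ T, c k * ∑ i ∈ s, w i * Complex.exp (k * a i * I) =
      ∑ i ∈ s, w i * ∑ k ∈ T, c k * Complex.exp (k * a i * I) := by
  simp_rw [Finset.mul_sum]
  rw [Finset.sum_comm]
  exact sum_congr rfl fun i _ => sum_congr rfl fun k _ => by ring

/-- **Truncated separation** (the step (16.9) ⇒ (16.10)): a pointwise truncation error `E` for
`u(α) - Σ_{k ∈ T} c(k) e^{ikα}` costs `E · Σ_i |w_i|` in the finite sum `Σ_i w_i u(a_i)`.
[cite: FriedlanderIwaniecAnnals1998, (16.9)–(16.10)] -/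
theorem norm_sum_mul_sub_trunc_le (s : Finset ι) (w : ι → ℂ) (a : ι → ℝ) {u : ℝ → ℝ} {c : ℤ → ℂ}
    {T : Finset ℤ} {E : ℝ} (hu : ∀ α : ℝ, ‖(u α : ℂ) - ∑ k ∈ T, c k * Complex.exp (k * α * I)‖ ≤ E) :
    ‖∑ i ∈ s, w i * (u (a i) : ℂ) - ∑ k ∈ T, c k * ∑ i ∈ s, w i * Complex.exp (k * a i * I)‖ ≤
      E * ∑ i ∈ s, ‖w i‖ := by
  rw [lss_sum_comm, ← Finset.sum_sub_distrib]
  simp_rw [← mul_sub]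
  refine (norm_sum_le _ _).trans ?_
  rw [Finset.mul_sum]
  refine sum_le_sum fun i _ => ?_
  rw [norm_mul, mul_comm]
  exact mul_le_mul_of_nonneg_right (hu (a i)) (norm_nonneg _)

/-- **Full separation** (the step (15.5) in (15.2)): if `u(α) = Σ_k c(k) e^{ikα}` for every `α`, then
`Σ_i w_i u(a_i) = Σ_k c(k) (Σ_i w_i e^{ika_i})`. [cite: FriedlanderIwaniecAnnals1998, §15 (15.5) inserted in (15.2)] -/
theorem hasSum_sum_mul_fourier (s : Finset ι) (w : ι → ℂ) (a : ι → ℝ) {u : ℝ → ℝ} {c : ℤ → ℂ}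
    (hu : ∀ α : ℝ, HasSum (fun k : ℤ => c k * Complex.exp (k * α * I)) (u α : ℂ)) :
    HasSum (fun k : ℤ => c k * ∑ i ∈ s, w i * Complex.exp (k * a i * I))
      (∑ i ∈ s, w i * (u (a i) : ℂ)) := by
  have h := hasSum_sum (s := s) (f := fun i k => w i * (c k * Complex.exp (k * a i * I)))
    fun i _ => (hu (a i)).mul_left (w i)
  convert h using 1
  funext k
  rw [Finset.mul_sum]
  exact sum_congr rfl fun i _ => by ring

/-- **The cost of the separation is `Σ_k |c(k)|`** (§15: "we achieve the separation of variables at the cost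
of `O((log N)²)`"): `|Σ_i w_i u(a_i)| ≤ (Σ_k |c(k)|) · B` whenever every separated sum satisfies
`|Σ_i w_i e^{ika_i}| ≤ B`. [cite: FriedlanderIwaniecAnnals1998, §15 after (15.7)] -/
theorem norm_sum_mul_le_tsum_mul (s : Finset ι) (w : ι → ℂ) (a : ι → ℝ) {u : ℝ → ℝ} {c : ℤ → ℂ}
    (hu : ∀ α : ℝ, HasSum (fun k : ℤ => c k * Complex.exp (k * α * I)) (u α : ℂ))
    (hc : Summable fun k => ‖c k‖) {B : ℝ}
    (hB : ∀ k : ℤ, ‖∑ i ∈ s, w i * Complex.exp (k * a i * I)‖ ≤ B) :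
    ‖∑ i ∈ s, w i * (u (a i) : ℂ)‖ ≤ (∑' k : ℤ, ‖c k‖) * B := by
  have h := hasSum_sum_mul_fourier s w a hu
  have hg : HasSum (fun k : ℤ => ‖c k‖ * B) ((∑' k : ℤ, ‖c k‖) * B) := by
    rw [← tsum_mul_right]; exact (hc.mul_right B).hasSum
  refine HasSum.norm_le_of_bounded h hg fun k => ?_
  rw [norm_mul]
  exact mul_le_mul_of_nonneg_left (hB k) (norm_nonneg _)

end Separation

/-! ### The two uses for the log-sine mollifier `u_H` -/

/-- **Separation of variables by the mollified logarithm, with the constants of (15.7) and (16.9).**  There is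
an absolute `C > 0` such that for every `H ≥ 2` there are coefficients `û_H : ℤ → ℂ` (the Fourier coefficients
of `u_H = logSineMollifier H`, `|û_H(k)| ≤ log 4H`, `Σ_k |û_H(k)| ≤ C log²(4H)`) such that for EVERY finite sum
`Σ_i w_i u_H(a_i)` (any index type; in the source `i = (z₁, z₂)`, `a_i = arg z₁ - arg z₂`):
(i) `Σ_i w_i u_H(a_i) = Σ_k û_H(k) Σ_i w_i e^{ika_i}`; (ii) (§15) `|Σ_i w_i u_H(a_i)| ≤ C log²(4H) · B` whenever
`|Σ_i w_i e^{ika_i}| ≤ B` for all `k`; (iii) (§16, (16.9) ⇒ (16.10))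
`|Σ_i w_i u_H(a_i) - Σ_{|k| ≤ K} û_H(k) Σ_i w_i e^{ika_i}| ≤ C·H·log(4H)·K⁻¹ · Σ_i |w_i|` (`K ≥ 1`; printed
error `O(K⁻¹H² log H)` times the trivial bound, for the printed non-smooth cutoff).
[cite: FriedlanderIwaniecAnnals1998, §15 (15.5)–(15.7) in (15.2); §16 (16.9)–(16.10)] -/
theorem exists_logSineMollifier_separation : ∃ C : ℝ, 0 < C ∧ ∀ H : ℝ, 2 ≤ H →
    ∃ c : ℤ → ℂ, (∀ k, ‖c k‖ ≤ Real.log (4 * H)) ∧ (Summable fun k => ‖c k‖) ∧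
      (∑' k : ℤ, ‖c k‖ ≤ C * Real.log (4 * H) ^ 2) ∧
      (∀ (ι : Type u) (s : Finset ι) (w : ι → ℂ) (a : ι → ℝ),
        HasSum (fun k : ℤ => c k * ∑ i ∈ s, w i * Complex.exp (k * a i * I))
          (∑ i ∈ s, w i * (logSineMollifier H (a i) : ℂ))) ∧
      (∀ (ι : Type u) (s : Finset ι) (w : ι → ℂ) (a : ι → ℝ) (B : ℝ),
        (∀ k : ℤ, ‖∑ i ∈ s, w i * Complex.exp (k * a i * I)‖ ≤ B) →
          ‖∑ i ∈ s, w i * (logSineMollifier H (a i) : ℂ)‖ ≤ C * Real.log (4 * H) ^ 2 * B) ∧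
      ∀ (ι : Type u) (s : Finset ι) (w : ι → ℂ) (a : ι → ℝ) (K : ℕ), 1 ≤ K →
        ‖∑ i ∈ s, w i * (logSineMollifier H (a i) : ℂ) -
            ∑ k ∈ Finset.Icc (-(K : ℤ)) K, c k * ∑ i ∈ s, w i * Complex.exp (k * a i * I)‖ ≤
          C * H * Real.log (4 * H) / K * ∑ i ∈ s, ‖w i‖ := by
  obtain ⟨C, hC, hmain⟩ := exists_fourier_logSineMollifier
  refine ⟨C, hC, fun H hH => ?_⟩
  obtain ⟨c, hc0, -, -, hsum, hfin, hhas, htrunc⟩ := hmain H hH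
  have htsum : ∑' k : ℤ, ‖c k‖ ≤ C * Real.log (4 * H) ^ 2 := hsum.tsum_le_of_sum_le hfin
  refine ⟨c, hc0, hsum, htsum, fun ι s w a => hasSum_sum_mul_fourier s w a hhas, ?_, ?_⟩
  · intro ι s w a B hB
    have hB0 : 0 ≤ B := (norm_nonneg _).trans (hB 0)
    exact (norm_sum_mul_le_tsum_mul s w a hhas hsum hB).trans (mul_le_mul_of_nonneg_right htsum hB0)
  · intro ι s w a K hK
    exact norm_sum_mul_sub_trunc_le s w a fun α => htrunc K hK α

end Literature.NumberTheory.Sieve.FriedlanderIwaniecPrimes
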